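import Summits.Parity.BatemanHorn.Theses.AlmostPrimeZeros
import Literature.NumberTheory.LFunctions.SelbergDelangeTheorem
import Literature.NumberTheory.LFunctions.HallTenenbaumTheorem01
import Literature.Analysis.Complex.BacklundJensenAverage

/-!
# Line `loglog-disc-explicit-lsd` for crux `LinearCappedRepulsion` (stmt-Parity-11327) — skeleton

Route `AlmostPrimeZeros` (sub-problem `BatemanHorn`), crux #5 (calibration `k = 1`, `f = X`):
`LinearCappedRepulsion = ∃ C, ∀ x ≥ 2, T(x) := Σ_ρ ‖1 − ρ‖⁻² ≤ C`, `ρ` over the roots (with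
multiplicity) of `P_x(z) = Σ_{0 ≤ n ≤ x} z^{s(n)} ∈ ℂ[z]`, `s(n) = Σ_{p^v ∥ n} min(v, 2)`.
Notation: `L = log log x`, `w = z − 1`, `λ(z) = ∏_p (1 + z/p + z²/(p(p−1)))(1 − 1/p)^z` (the
Euler product of the capped statistic at `s = 1`; entire, `λ(0) = λ(1) = 1`),
`J_x(R) = Σ_ρ log⁺(R/‖ρ − 1‖)` (Jensen sum at the free centre `z = 1`, `P_x(1) = x + 1`).

**Idea (crux idea `loglog-disc-explicit-lsd`, ideator 3; triage r1-1/2/3: pass).** The lever is an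
EXPLICIT two-sided Landau–Selberg–Delange law for the capped statistic, uniform on the growing disc
`‖z − 1‖ ≤ L/C` with the natural loss `e^{C(|z|+3) log(|z|+3)}`:
`P_x(z) = x (log x)^{z−1} λ(z)/Γ(z) + O(x (log x)^{Re z − 2} e^{C(|z|+3)log(|z|+3)})` (`stub_explicitLSD`,
the load-bearing stub: a constants-explicit port of the tree's PROVED contour engine
`SelbergDelange.exists_riesz_expansion` / `MontgomeryVaughan2007_thm_7_18_holds`, which is the
fixed-radius case). The conversion to the crux honours the triage kill-condition (NO Rouché /
zero TRACKING on the full disc from an absolute-error law — the "log L trap" of Disproof.lean; only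
zero COUNTING by Jensen, which upper bounds cannot fool):

1. `stub_eulerFactorGrowth` + `stub_recipGammaGrowth`: `|λ(z)|, |1/Γ(z)| ≤ e^{C(|z|+3)log(|z|+3)}`, so the
   upper half of the law is a TILTED MAJORANT `‖P_x(1+w)‖ ≤ exp(M(R) + L·Re w)` on `‖w‖ = R ≤ L/C'`
   with `M(R) = log x + log 2 + C₃ (R+4) log(R+4)` — NO `x`-growth beyond the harmonic factor.
2. `stub_jensenPolynomial` (Jensen's formula for a polynomial at the free centre `1`; the harmonic
   tilt `L·Re w` has circle mean `0`): `J_x(R) ≤ M(R) − log(x+1) ≤ A (R+4) log(R+4)` for `R ≤ L/C'`.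
3. `stub_hallTenenbaumMajorant` (positivity + Hall–Tenenbaum Thm 01 + Mertens: `Σ_{n≤x} y^{s(n)} ≤
   K(y+1)² x (log x)^{y−1} e^{Ky}`): on EVERY circle `J_x(R) ≤ (2L + K₂) R` (`R ≥ 1`).
4. `stub_jensenSumsToRepulsion` (Stieltjes: `Σ a⁻² = 4∫₀^∞ J(R) R⁻³ dR`; zero-free radius
   `e^{−5A log 5}` read off `J(1)`): `T(x) ≤ Φ(A) + κ (2L + K₂)/(L/C') ≤ Φ(A) + |κ|(2 + K₂)C'`.
5. Small `x` (`log log x < C'`): finitely many, each `T(x)` a finite sum (composition, proved).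

`LinearCappedRepulsion_of` is the kernel-checked composition (no `sorry` outside the six `stub_*`).
Hardest stub: `stub_explicitLSD` (XL). The other five are M-sized and independent of each other.

Disproof.lean (cdisprove rev 3, read through its evidence notes — the `run/gate` path is not mounted
in this jail) honoured: `linearCappedRepulsion_false_without_cap` — the cap `min(v,2)` is USED in
`stub_explicitLSD` (the local factor `1 + z p^{-s} + z² p^{-2s}/(1 − p^{-s})` is a polynomial-type
factor, entire in `z`, so the law holds on every radius; for `Ω` the pole at `2^s = z` caps `R < 2`)
and in `stub_hallTenenbaumMajorant` (`h(p^v) = 0` for `v ≥ 3`, `B ≍ y²`); its reduction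
`UniformUpperBound R η ⇒ crux` (Jensen alone, any `η < 2`) is exactly steps 1–4 (our `η = 1⁺`);
refuted strengthenings (`T` monotone — `T 5 = 13/36 < 2/5 = T 4`; real-rootedness of `S_4`) are not
assumed by any stub; `2 ≤ x` decorative (`iff_all_x`) — small `x` are handled by finiteness, not by
the hypothesis. Negatives index (`ledger negatives --problem Parity`, 3 items, all
GeneralizedHardyLittlewood): none concerns these objects. Barrier catalogue
(`Literature/Barriers/Parity/*`): no entry bites `f = X` — the signed sums `Σ_n (−r)^{s(n)}` that the
crux controls are zero-free-region theorems for `ζ`, and the line INPUTS the classical region through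
the tree's engine (`SelbergParityBarrier`, `UniformBatemanHornBarrier` concern sieve-type inputs /
uniformity in the polynomial, neither used here).
-/

noncomputable section

namespace Summit.Parity.BatemanHorn.Cruxes.LinearCappedRepulsion.LoglogDiscExplicitLsd

open Filter Topology

/-! ## Stubs (registered obligations of the line; `sorry` only here) -/

/-- **Stub 1 — explicit Landau–Selberg–Delange law on the disc `‖z − 1‖ ≤ (log log x)/C` (XL; the
load-bearing stub; HARDEST).** For the Euler product `Λ = λ` of the capped statistic (pinned by the
hypothesis: the pointwise limit of the finite products over `p < N`), there is ONE constant `C > 0` with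
`‖Σ_{0≤n≤x} z^{s(n)} − x (log x)^{z−1} λ(z) Γ(z)⁻¹‖ ≤ x (log x)^{Re z−2} e^{C(|z|+3) log(|z|+3)}` for all
`x ≥ 3` and all `‖z − 1‖ ≤ (log log x)/C`. Why plausibly true: this is Selberg–Delange
(MV Thm 7.18 / Tenenbaum II.5 Thm 5.2) with the `R`-dependence of the constants made explicit —
re-traced independently by three triagers and the crux-attack refuter: Perron/Riesz mean of order one
(tree engine `SelbergDelange.exists_riesz_expansion`, PROVED for fixed `R`, constants already of the
shape `exp(R·C₀)`: `exists_norm_zetaPow_le_far/near`), contour at height `T = (log x)^{κ}`,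
`κ = 2R + N + 1`, inside the classical zero-free region (`zero_free_region_classical_holds`), keyhole
+ Hankel loop of radius `1/log x` (`|1/Γ|`-type constants `e^{O(R log R)}`), smooth factor
`G(s;z) = Σ z^{s(n)} n^{-s} ζ(s)^{-z} = ∏_p (1 + z p^{-s} + z² p^{-2s}/(1−p^{-s}))(1 − p^{-s})^z` with
`log|G| = O(|z| log log |z|)` on `σ ≥ 1 − 1/log(|z|+3)` (take `σ₁ = 1 − 1/log(R+3)` in `RieszData`; the
majorant `Σ R^{s(n)} n^{-σ} ≤ e^{O(R)} (σ−1)^{-R}`), `N ≍ 4R + 2` expansion terms (the `k ≥ 1` terms are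
`≤ x(log x)^{Re z−2} e^{O(R log R)}`, geometric in `k`), de-smoothing by the tree's second-difference
argument (`SelbergDelangeOmega.norm_summatory_sub_le`, `h = x(log x)^{−2R−1}`) — every constant is
`e^{O(R log R)}` and the threshold is `log x ≥ e^{c₀ R}`, i.e. exactly `R ≤ (log log x)/c₀`; bounded `x`
and `‖z−1‖ < 1` are absorbed by the PROVED fixed-radius theorem `MontgomeryVaughan2007_thm_7_18_holds`
(`R = 2`) / the crude bound `|P_x(z)| ≤ (x+1)x²`. NOT in print as stated (MV/Tenenbaum: `|z| ≤ R`
fixed). Why it might fail: only through a constant of size `e^{cR²}` hiding in a sloppy majorant (the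
local factors at `p ≤ R` must be bounded by `4R²`, not by `(1+p^{-σ})^{R}`-comparison) or in the
de-smoothing window — both checked on paper (triage S2(iv)); if a port lands at loss `e^{C R^η}`,
`η < 2`, reshape `(R+4)log(R+4)` in Stub 6's first hypothesis accordingly (any `η < 2` converts).
Two-sidedness is the idea's identity (it also pins the near zeros and is the `k = 1` case of
`SystemLSDRealSegment`); `LinearCappedRepulsion_of` consumes only the upper half.
[cite: MontgomeryVaughan2007, §7.4 Thm 7.17–7.18, pp. 177–179; Tenenbaum2015, II.5 Thm 5.2, II.5.4;
Selberg1954] -/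
theorem stub_explicitLSD :
    ∀ Λ : ℂ → ℂ,
      (∀ z : ℂ, Tendsto (fun N : ℕ => ∏ p ∈ Nat.primesBelow N,
          ((1 + z / (p : ℂ) + z ^ 2 / ((p : ℂ) * ((p : ℂ) - 1))) * (1 - 1 / (p : ℂ)) ^ z))
        atTop (𝓝 (Λ z))) →
      ∃ C : ℝ, 0 < C ∧ ∀ x : ℕ, 3 ≤ x → ∀ z : ℂ,
        ‖z - 1‖ ≤ Real.log (Real.log x) / C →
        ‖(∑ n ∈ Finset.range (x + 1), z ^ (n.factorization.sum fun _ v => min v 2)) -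
            (x : ℂ) * Complex.exp ((z - 1) * (Real.log (Real.log x) : ℂ)) * Λ z *
              (Complex.Gamma z)⁻¹‖ ≤
          (x : ℝ) * Real.exp ((z.re - 2) * Real.log (Real.log x)) *
            Real.exp (C * (‖z‖ + 3) * Real.log (‖z‖ + 3)) := by
  sorry

/-- **Stub 2 — the Euler product `λ(z)` exists and has order-one growth (M).** The finite products
`∏_{p<N} (1 + z/p + z²/(p(p−1)))(1 − 1/p)^z` converge for every `z` (each factor is
`1 + O((|z|+|z|³)/p²)` for `p ≥ 2|z|²+2`: expand `(1−1/p)^z = exp(z log(1−1/p)) = 1 − z/p + O((|z|+|z|²)/p²)`;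
a vanishing factor — `z = z_p`, a zero of the local factor, `|1 − z_p| = p` — makes the products
eventually `0`) and the limit satisfies `‖λ(z)‖ ≤ e^{C(|z|+3)log(|z|+3)}` (truth: `|z| log log|z| + O(|z|)`;
the stated allowance needs only crude inputs: for `p ≤ |z|`, `|factor| ≤ 4(|z|+1)² e^{2|z|/p}`, at most
`|z|+1` such primes; for `|z| < p < 2|z|²+2`, `log|factor| ≤ |z|/p + 2|z|²/p² + 2|z|/p` and the harmonic
bound `Σ_{n ≤ Y} 1/n ≤ log Y + 1`; the tail `p ≥ 2|z|²+2` is `O(1)`). Numerics (triage r1-3):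
`max_{|w|=R} log|λ(1+w)/Γ(1+w)| / (R log(R+2)) ≤ 1.70` for `R ≤ 30`. Why it might fail: it does not
(absolutely convergent product of an entire function of order 1); cost = `Complex.cpow` of the positive
real base `1 − 1/p`, `‖exp w − 1 − w‖ ≤ ‖w‖² e^{‖w‖}` bookkeeping, `Nat.primesBelow` monotone limits.
[cite: Tenenbaum2015, II.5 Thm 5.2 and II.6.1; MontgomeryVaughan2007, §7.4 p. 179] -/
theorem stub_eulerFactorGrowth :
    ∃ C : ℝ, 0 < C ∧ ∃ Λ : ℂ → ℂ,
      (∀ z : ℂ, Tendsto (fun N : ℕ => ∏ p ∈ Nat.primesBelow N,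
          ((1 + z / (p : ℂ) + z ^ 2 / ((p : ℂ) * ((p : ℂ) - 1))) * (1 - 1 / (p : ℂ)) ^ z))
        atTop (𝓝 (Λ z))) ∧
      ∀ z : ℂ, ‖Λ z‖ ≤ Real.exp (C * (‖z‖ + 3) * Real.log (‖z‖ + 3)) := by
  sorry

/-- **Stub 3 — `1/Γ` is of order one, maximal type (M; Mathlib special functions).**
`‖Γ(z)⁻¹‖ ≤ e^{C(|z|+3) log(|z|+3)}` for all `z ∈ ℂ` (Mathlib's junk `Γ(−n) = 0` gives `Γ(−n)⁻¹ = 0`,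
the true value of the entire function `1/Γ`). Proof plan: Euler's limit formula
`Complex.GammaSeq_tendsto_Gamma` (`Γ(z) = lim nᶻ n!/(z(z+1)⋯(z+n))`), so
`|1/Γ(z)| = lim |z| ∏_{k≤n} |1 + z/k| · n^{−Re z}`; for `k ≤ 2|z|`, `∏ (1 + |z|/k) ≤ 4^{2|z|}`; for
`k > 2|z|`, `log|1 + z/k| ≤ Re z/k + |z|²/k²` and `Σ_{2|z|<k≤n} 1/k = log n − log(2|z|) + O(1/|z|)`, so the
`log n` terms cancel and `log|1/Γ(z)| ≤ log|z| + O(|z|) − Re z · log(2|z|) ≤ C(|z|+3)log(|z|+3)`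
(alternatively: reflection formula `Complex.Gamma_mul_Gamma_one_sub` on `Re z ≤ 1/2` with
`|Γ(w)| ≤ Γ(Re w)` and `|sin πz| ≤ e^{π|Im z|}`, functional equation on the right). Why it might fail: it
does not (classical: `1/Γ` has order 1 and type ∞ with `log M(r) ∼ r log r`).
[cite: WhittakerWatson1927, §12.1–12.11 (Euler's formula), §12.33; Boas1954, §2.9–2.10 (order and type);
Conway1978, VII §7] -/
theorem stub_recipGammaGrowth :
    ∃ C : ℝ, 0 < C ∧ ∀ z : ℂ,
      ‖(Complex.Gamma z)⁻¹‖ ≤ Real.exp (C * (‖z‖ + 3) * Real.log (‖z‖ + 3)) := by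
  sorry

/-- **Stub 4 — Rankin / Hall–Tenenbaum positivity majorant, uniform in `y ≥ 0` (M; tree inputs
proved).** `Σ_{0≤n≤x} y^{s(n)} ≤ K (y+1)² x (log x)^{y−1} e^{Ky}` for all `x ≥ 3`, `y ≥ 0`, ONE `K`.
Proof plan: `f(n) = y^{s(n)}` is non-negative multiplicative with `f(p) = y`, `f(p^v) = y²` (`v ≥ 2`:
the cap), so Hall–Tenenbaum Thm 01 (`Literature.NumberTheory.LFunctions.HallTenenbaum.theorem01`,
PROVED, explicit constant `A + B + 1`) applies with `A = y log 4` (Chebyshev,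
`Chebyshev.theta_le_log4_mul_x`) and `B = y² B₁` (`HallTenenbaum.B₁`, the `v ≥ 2` double sum):
`Σ_{n≤x} f(n) ≤ (y log 4 + B₁ y² + 1)(x/log x) Σ_{n≤x} f(n)/n`, and by (0.4)
(`HallTenenbaum.sum_div_le_prod_tsum`) `Σ_{n≤x} f(n)/n ≤ ∏_{p≤x}(1 + y/p + y²/(p(p−1)))`, whose
logarithm is `≤ y Σ_{y<p≤x} 1/p + Σ_{p≤min(y,x)} log(3(y+1)²/p²) + O(y) ≤ y log log x + O(y)`
(Mertens `Σ_{p≤x} 1/p ≤ log log x + c`, tree `Mertens.tendsto_primeRecipSum_sub_loglog` /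
`MertensFromChebyshev`; for `p ≤ y` each local factor is `≤ 3(y+1)²/p²`-sized and
`Σ_{p≤y} log(y/p) = π(y) log y − θ(y) ≤ C y` by `Chebyshev.pi_le_log4_mul_div`); the `n = 0` term
(`s(0) = 0`, not in Hall–Tenenbaum's range `1 ≤ n ≤ x`) costs `1 ≤ K x/log x`. NO `y²` in the
exponent (triage r1-1/2/3 agree; numerics: `(log(P_x(1+r)/(x+1)) − rL)/r ≤ 0.35` for `r ≥ 0.5`,
`x ≤ 3·10⁵`). Why it might fail: it does not for `y ≤ x`; for `y > x` the bound is cruder than the truth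
but still true (`Σ_{p≤x} log(3y²/p²) ≤ 2π(x) log y + O(x) ≤ Ky`). [cite: HallTenenbaum1988, §0.2 Thm 01
and (0.4), p. 2; Tenenbaum2015, III.3.5; Shiu1980, Thm 1] -/
theorem stub_hallTenenbaumMajorant :
    ∃ K : ℝ, 0 < K ∧ ∀ x : ℕ, 3 ≤ x → ∀ y : ℝ, 0 ≤ y →
      (∑ n ∈ Finset.range (x + 1), y ^ (n.factorization.sum fun _ v => min v 2)) ≤
        K * (y + 1) ^ 2 * x * Real.exp ((y - 1) * Real.log (Real.log x) + K * y) := by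
  sorry

/-- **Stub 5 — Jensen's formula for a polynomial at the free centre `1`, with a harmonic tilt (M;
Mathlib).** If `P(1) ≠ 0` and `‖P(1+w)‖ ≤ exp(M + Λ·Re w)` on the circle `‖w‖ = R > 0`, then
`Σ_{ρ ∈ roots P} log⁺(R/‖ρ − 1‖) ≤ M − log‖P(1)‖` (roots with multiplicity; `log⁺ = Real.posLog`).
Proof plan: Jensen `Σ_{‖ρ−1‖<R} log(R/‖ρ−1‖) = circleAverage (log‖P(1+·)‖) 0 R − log‖P(1)‖`
(Mathlib `MeromorphicOn.circleAverage_log_norm` / `AnalyticOnNhd.circleAverage_log_norm`, or directly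
from `P = c ∏ (X − ρ)` and `circleAverage_log_norm_sub_const_eq_posLog`:
`circleAverage (log‖· − a‖) 0 1 = log⁺‖a‖`, rescaled), then `circleAverage ≤ M + Λ · circleAverage (Re w)
= M` since `Re w` has mean zero on circles centred at `0` (tree:
`Literature.Analysis.Complex.circleAverage_re_eq`, `sum_divisor_le_of_circleAverage_le` is the same
inequality in divisor language). Degenerate cases: `deg P = 0` gives `0 ≤ M − log‖c‖`, true by the
hypothesis at `w = iR`; a root AT distance `R` contributes `log⁺ 1 = 0`. Why it might fail: it does not
(Jensen 1899); cost = matching `Polynomial.roots` multiplicities with `MeromorphicOn.divisor`, or the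
product formula `Polynomial.eq_prod_roots_of_splits_id` over `ℂ`. [cite: Jensen1899; Conway1978, XI §1
(Jensen's formula); Rudin1987, Thm 15.18; Boas1954, §1.2] -/
theorem stub_jensenPolynomial :
    ∀ (P : Polynomial ℂ) (Λ M R : ℝ), 0 < R → P.eval 1 ≠ 0 →
      (∀ w : ℂ, ‖w‖ = R → ‖P.eval (1 + w)‖ ≤ Real.exp (M + Λ * w.re)) →
      (P.roots.map fun ρ : ℂ => Real.posLog (R / ‖ρ - 1‖)).sum ≤ M - Real.log ‖P.eval 1‖ := by
  sorry

/-- **Stub 6 — from Jensen sums to the repulsion sum (M; real analysis, the Stieltjes conversion).**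
There are a function `Φ` and an absolute `κ` such that for every finite multiset `s` of positive reals
(the moduli `‖ρ − 1‖`), every `A, B ≥ 0`, `R₁ ≥ 1`: if `J(R) := Σ_{a∈s} log⁺(R/a) ≤ A(R+4)log(R+4)` for
`0 < R ≤ R₁` and `J(R) ≤ B R` for `R ≥ R₁`, then `Σ_{a∈s} a⁻² ≤ Φ(A) + κ B/R₁`. Proof plan: (i) at
`R = 1 ≤ R₁` every single term gives `log⁺(1/a) ≤ 5A log 5`, so `a ≥ r₀(A) := e^{−5A log 5}` and
`J ≡ 0` on `(0, r₀)`; (ii) the exact identity `∫₀^∞ log⁺(R/a) R⁻³ dR = 1/(4a²)`, i.e.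
`Σ a⁻² = 4 ∫₀^∞ J(R) R⁻³ dR`, split at `R₁`: `≤ 4A ∫_{r₀(A)}^∞ (R+4)log(R+4) R⁻³ dR + 4B/R₁`
(so `κ = 4`; a dyadic version — `#{a ≤ t} ≤ J(et)`, shells `(e^k, e^{k+1}]` — gives `κ = e⁴/(1−e⁻¹)`
with no integrals; the statement leaves `κ` free). Why it might fail: it does not (elementary; the
hypotheses at `R = 1` force the zero-free radius, which is why `1 ≤ R₁` is required).
[cite: Boas1954, §1.2 and §2.5 (Jensen's formula and the counting function); Conway1978, XI §1] -/
theorem stub_jensenSumsToRepulsion :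
    ∃ (Φ : ℝ → ℝ) (κ : ℝ), ∀ (A B R₁ : ℝ) (s : Multiset ℝ), 0 ≤ A → 0 ≤ B → 1 ≤ R₁ →
      (∀ a ∈ s, 0 < a) →
      (∀ R : ℝ, 0 < R → R ≤ R₁ →
        (s.map fun a => Real.posLog (R / a)).sum ≤ A * (R + 4) * Real.log (R + 4)) →
      (∀ R : ℝ, R₁ ≤ R → (s.map fun a => Real.posLog (R / a)).sum ≤ B * R) →
      (s.map fun a => (a ^ 2)⁻¹).sum ≤ Φ A + κ * B / R₁ := by
  sorry

/-! ## Local abbreviations and glue (composition only; the stubs above are stated over existing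
declarations — workers cannot import this file) -/

/-- The capped statistic `s(n) = Σ_{p^v ∥ n} min(v, 2)`. -/
def capped (n : ℕ) : ℕ := n.factorization.sum fun _ v => min v 2

/-- `P_x = Σ_{0 ≤ n ≤ x} X^{s(n)} ∈ ℂ[X]`. -/
def cappedPoly (x : ℕ) : Polynomial ℂ :=
  ∑ n ∈ Finset.range (x + 1), (Polynomial.X : Polynomial ℂ) ^ capped n

/-- `T(x) = Σ_ρ ‖1 − ρ‖⁻²` over the roots of `P_x`. -/
def repulsion (x : ℕ) : ℝ :=
  ((cappedPoly x).roots.map fun ρ : ℂ => (‖(1 : ℂ) - ρ‖ ^ 2)⁻¹).sum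

theorem eval_cappedPoly (x : ℕ) (z : ℂ) :
    (cappedPoly x).eval z = ∑ n ∈ Finset.range (x + 1), z ^ capped n := by
  simp [cappedPoly, Polynomial.eval_finsetSum]

theorem eval_cappedPoly_one (x : ℕ) : (cappedPoly x).eval 1 = (x : ℂ) + 1 := by
  simp [eval_cappedPoly]

theorem eval_cappedPoly_one_ne_zero (x : ℕ) : (cappedPoly x).eval 1 ≠ 0 := by
  rw [eval_cappedPoly_one]
  exact_mod_cast Nat.succ_ne_zero x

theorem norm_eval_cappedPoly_one (x : ℕ) : ‖(cappedPoly x).eval 1‖ = (x : ℝ) + 1 := by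
  rw [eval_cappedPoly_one]
  exact_mod_cast Complex.norm_natCast (x + 1)

theorem repulsion_nonneg (x : ℕ) : 0 ≤ repulsion x :=
  Multiset.sum_nonneg fun a ha => by
    obtain ⟨ρ, -, rfl⟩ := Multiset.mem_map.1 ha
    positivity

theorem norm_sub_one_pos_of_mem_roots {x : ℕ} {ρ : ℂ} (h : ρ ∈ (cappedPoly x).roots) :
    0 < ‖ρ - 1‖ := by
  have hne : cappedPoly x ≠ 0 := fun h0 => eval_cappedPoly_one_ne_zero x (by simp [h0])
  have hroot := (Polynomial.mem_roots hne).1 h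
  have h1 : ρ ≠ 1 := by
    rintro rfl
    exact eval_cappedPoly_one_ne_zero x hroot
  exact norm_pos_iff.2 (sub_ne_zero.2 h1)

theorem repulsion_eq (x : ℕ) :
    repulsion x =
      (((cappedPoly x).roots.map fun ρ : ℂ => ‖ρ - 1‖).map fun a : ℝ => (a ^ 2)⁻¹).sum := by
  rw [repulsion, Multiset.map_map]
  congr 1
  refine Multiset.map_congr rfl fun ρ _ => ?_
  simp [norm_sub_rev]

theorem norm_sum_pow_le {x : ℕ} {z : ℂ} {y : ℝ} (h : ‖z‖ ≤ y) :
    ‖∑ n ∈ Finset.range (x + 1), z ^ capped n‖ ≤ ∑ n ∈ Finset.range (x + 1), y ^ capped n := by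
  refine (norm_sum_le _ _).trans (Finset.sum_le_sum fun n _ => ?_)
  rw [norm_pow]
  gcongr

theorem growth_mono {u v : ℝ} (hu : 0 ≤ u) (huv : u ≤ v) :
    (u + 3) * Real.log (u + 3) ≤ (v + 3) * Real.log (v + 3) := by
  have h1 : 0 ≤ Real.log (u + 3) := Real.log_nonneg (by linarith)
  exact mul_le_mul (by linarith) (Real.log_le_log (by linarith) (by linarith)) h1 (by linarith)

/-! ## The composition -/

set_option maxHeartbeats 1600000 in
/-- **Composition (kernel-checked; `sorry` only inside the six stubs).** `stub_explicitLSD`,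
`stub_eulerFactorGrowth`, `stub_recipGammaGrowth` ⇒ tilted majorant on the circles
`‖z−1‖ = R ≤ (log log x)/C'` ⇒ (`stub_jensenPolynomial`) `J_x(R) ≤ A(R+4)log(R+4)`;
`stub_hallTenenbaumMajorant` ⇒ (`stub_jensenPolynomial`) `J_x(R) ≤ (2 log log x + K₂) R` on every circle
`R ≥ 1`; `stub_jensenSumsToRepulsion` with `R₁ = (log log x)/C'` ⇒ `T(x) ≤ Φ(A) + |κ|(2 + K₂)C'`
whenever `log log x ≥ C' = max C 1`; the finitely many smaller `x` are bounded by the finite sum of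
their (finite) `T(x)`. Concludes `Theses.AlmostPrimeZeros.LinearCappedRepulsion` BY NAME. -/
theorem LinearCappedRepulsion_of : Theses.AlmostPrimeZeros.LinearCappedRepulsion := by
  classical
  obtain ⟨C₁, hC₁, Λ, hΛ, hΛg⟩ := stub_eulerFactorGrowth
  obtain ⟨C, hC, hLSD⟩ := stub_explicitLSD Λ hΛ
  obtain ⟨C₂, hC₂, hΓ⟩ := stub_recipGammaGrowth
  obtain ⟨K, hK, hRk⟩ := stub_hallTenenbaumMajorant
  obtain ⟨Φ, κ, hconv⟩ := stub_jensenSumsToRepulsion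
  -- constants of the line
  set C' : ℝ := max C 1 with hC'
  have hC'1 : 1 ≤ C' := le_max_right _ _
  have hCC' : C ≤ C' := le_max_left _ _
  have hC'0 : 0 < C' := by linarith
  set C₃ : ℝ := C₁ + C₂ + C with hC₃
  have hC₃0 : 0 ≤ C₃ := by positivity
  set A : ℝ := C₃ + 1 with hA
  have hA0 : 0 ≤ A := by positivity
  set K₂ : ℝ := |Real.log K| + 4 + 2 * K with hK₂
  have hK₂0 : 0 ≤ K₂ := by positivity
  set Mbig : ℝ := max (Φ A + |κ| * (2 * C' + K₂ * C')) 0 with hMbig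
  have hMbig0 : 0 ≤ Mbig := le_max_right _ _
  /- ### the bound for large `x` (`log log x ≥ C'`) -/
  have hlarge : ∀ x : ℕ, 3 ≤ x → C' ≤ Real.log (Real.log x) → repulsion x ≤ Mbig := by
    intro x hx3 hL
    set L : ℝ := Real.log (Real.log x) with hLdef
    have hL1 : 1 ≤ L := hC'1.trans hL
    have hL0 : 0 < L := by linarith
    have hx0 : (0 : ℝ) < x := by exact_mod_cast (by omega : 0 < x)
    have hx1 : (1 : ℝ) < x := by exact_mod_cast (by omega : 1 < x)
    have hlogx1 : Real.log x ≤ Real.log ((x : ℝ) + 1) := Real.log_le_log hx0 (by linarith)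
    set R₁ : ℝ := L / C' with hR₁
    have hR₁1 : 1 ≤ R₁ := by rw [hR₁, le_div_iff₀ hC'0]; linarith
    have hR₁C : R₁ ≤ L / C := by
      rw [hR₁]; exact div_le_div_of_nonneg_left hL0.le hC hCC'
    -- the moduli `‖ρ − 1‖` of the (shifted) zeros
    set rts : Multiset ℝ := (cappedPoly x).roots.map fun ρ : ℂ => ‖ρ - 1‖ with hrts
    have hpos : ∀ a ∈ rts, 0 < a := by
      intro a ha
      obtain ⟨ρ, hρ, rfl⟩ := Multiset.mem_map.1 ha
      exact norm_sub_one_pos_of_mem_roots hρ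
    have hJ : ∀ R : ℝ, (rts.map fun a => Real.posLog (R / a)).sum =
        ((cappedPoly x).roots.map fun ρ : ℂ => Real.posLog (R / ‖ρ - 1‖)).sum := by
      intro R
      rw [hrts, Multiset.map_map]
      rfl
    /- (H1) near circles: explicit LSD + growth of `λ`, `1/Γ` + Jensen at the free centre -/
    have H1 : ∀ R : ℝ, 0 < R → R ≤ R₁ →
        (rts.map fun a => Real.posLog (R / a)).sum ≤ A * (R + 4) * Real.log (R + 4) := by
      intro R hR hRR₁
      set G : ℝ := (R + 4) * Real.log (R + 4) with hG
      have hlog4 : Real.log 2 ≤ Real.log (R + 4) := Real.log_le_log two_pos (by linarith)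
      have hlog2 : 0 < Real.log 2 := Real.log_pos one_lt_two
      have hlogR0 : 0 ≤ Real.log (R + 4) := by linarith
      have hG2 : Real.log 2 ≤ G := by
        rw [hG]
        exact hlog4.trans (le_mul_of_one_le_left hlogR0 (by linarith))
      have hG0 : 0 ≤ G := by linarith
      set M : ℝ := Real.log x + Real.log 2 + C₃ * G with hM
      have hbound : ∀ w : ℂ, ‖w‖ = R →
          ‖(cappedPoly x).eval (1 + w)‖ ≤ Real.exp (M + L * w.re) := by
        intro w hw
        set z : ℂ := 1 + w with hz
        have hzre : z.re - 1 = w.re := by simp [hz]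
        have hz1 : ‖z - 1‖ ≤ Real.log (Real.log x) / C := by
          rw [hz, add_sub_cancel_left, hw]
          exact hRR₁.trans hR₁C
        have herr := hLSD x hx3 z hz1
        rw [eval_cappedPoly]
        -- the growth scale at `z`
        set g : ℝ := (‖z‖ + 3) * Real.log (‖z‖ + 3) with hg
        have hzn : ‖z‖ ≤ R + 1 := by
          rw [hz]
          calc ‖(1 : ℂ) + w‖ ≤ ‖(1 : ℂ)‖ + ‖w‖ := norm_add_le _ _
            _ = R + 1 := by rw [norm_one, hw]; ring
        have hg0 : 0 ≤ g := by
          have : 0 ≤ Real.log (‖z‖ + 3) := Real.log_nonneg (by linarith [norm_nonneg z])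
          positivity
        have hgG : g ≤ G := by
          have h := growth_mono (norm_nonneg z) hzn
          rw [show R + 1 + 3 = R + 4 by ring] at h
          rw [hg, hG]
          exact h
        -- sizes of the main term and of the error term
        set E : ℝ := Real.exp ((z.re - 1) * L) with hE
        have hE0 : 0 < E := Real.exp_pos _
        have h1 : ‖Λ z‖ ≤ Real.exp (C₁ * g) := by rw [hg, ← mul_assoc]; exact hΛg z
        have h2 : ‖(Complex.Gamma z)⁻¹‖ ≤ Real.exp (C₂ * g) := by rw [hg, ← mul_assoc]; exact hΓ z
        have hre : ((z - 1) * (L : ℂ)).re = (z.re - 1) * L := by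
          simp [Complex.mul_re]
        have hnmain : ‖(x : ℂ) * Complex.exp ((z - 1) * (L : ℂ)) * Λ z * (Complex.Gamma z)⁻¹‖ ≤
            x * E * Real.exp (C₃ * G) := by
          simp only [norm_mul, Complex.norm_natCast, Complex.norm_exp, hre]
          rw [← hE]
          calc (x : ℝ) * E * ‖Λ z‖ * ‖(Complex.Gamma z)⁻¹‖
              ≤ x * E * Real.exp (C₁ * g) * Real.exp (C₂ * g) := by gcongr
            _ = x * E * Real.exp (C₁ * g + C₂ * g) := by rw [Real.exp_add]; ring
            _ ≤ x * E * Real.exp (C₃ * G) := by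
                gcongr
                have h3 : (C₁ + C₂) * g ≤ (C₁ + C₂) * G :=
                  mul_le_mul_of_nonneg_left hgG (add_nonneg hC₁.le hC₂.le)
                have h4 : (C₁ + C₂) * G ≤ C₃ * G :=
                  mul_le_mul_of_nonneg_right (by rw [hC₃]; linarith) hG0
                linarith
        have herr' : (x : ℝ) * Real.exp ((z.re - 2) * L) * Real.exp (C * (‖z‖ + 3) * Real.log (‖z‖ + 3)) ≤
            x * E * Real.exp (C₃ * G) := by
          have hE' : Real.exp ((z.re - 2) * L) ≤ E := by
            rw [hE]
            exact Real.exp_le_exp.2 (mul_le_mul_of_nonneg_right (by linarith) hL0.le)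
          have hexp2 : Real.exp (C * (‖z‖ + 3) * Real.log (‖z‖ + 3)) ≤ Real.exp (C₃ * G) := by
            rw [mul_assoc, ← hg]
            refine Real.exp_le_exp.2 ?_
            have h3 : C * g ≤ C * G := mul_le_mul_of_nonneg_left hgG hC.le
            have h4 : C * G ≤ C₃ * G := mul_le_mul_of_nonneg_right (by rw [hC₃]; linarith) hG0
            linarith
          gcongr
        have hkey : Real.exp (M + L * w.re) = 2 * (x * E * Real.exp (C₃ * G)) := by
          rw [hM, hE, hzre]
          simp only [Real.exp_add]
          rw [Real.exp_log hx0, Real.exp_log two_pos, mul_comm (w.re) L]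
          ring
        calc ‖∑ n ∈ Finset.range (x + 1), z ^ capped n‖
            ≤ ‖(x : ℂ) * Complex.exp ((z - 1) * (L : ℂ)) * Λ z * (Complex.Gamma z)⁻¹‖ +
              ‖(∑ n ∈ Finset.range (x + 1), z ^ capped n) -
                (x : ℂ) * Complex.exp ((z - 1) * (L : ℂ)) * Λ z * (Complex.Gamma z)⁻¹‖ :=
              norm_le_insert' _ _
          _ ≤ x * E * Real.exp (C₃ * G) + x * E * Real.exp (C₃ * G) := add_le_add hnmain (herr.trans herr')
          _ = Real.exp (M + L * w.re) := by rw [hkey]; ring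
      have hJen := stub_jensenPolynomial (cappedPoly x) L M R hR (eval_cappedPoly_one_ne_zero x) hbound
      rw [hJ R]
      refine hJen.trans ?_
      rw [norm_eval_cappedPoly_one, hM]
      have hAG : A * (R + 4) * Real.log (R + 4) = C₃ * G + G := by rw [hA, hG]; ring
      rw [hAG]
      linarith
    /- (H2) far circles: positivity + Rankin/Hall–Tenenbaum majorant + Jensen -/
    have H2 : ∀ R : ℝ, R₁ ≤ R → (rts.map fun a => Real.posLog (R / a)).sum ≤ (2 * L + K₂) * R := by
      intro R hR₁R
      have hR1 : 1 ≤ R := hR₁1.trans hR₁R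
      have hR0 : 0 < R := by linarith
      have hRk' := hRk x hx3 (1 + R) (by linarith)
      set Q : ℝ := Real.log K + 2 * (R + 1) + Real.log x + (R * L + K * (1 + R)) with hQ
      have hX₀ : K * (1 + R + 1) ^ 2 * x * Real.exp ((1 + R - 1) * L + K * (1 + R)) ≤ Real.exp Q := by
        have e1 : Real.exp (Real.log K) = K := Real.exp_log hK
        have e3 : Real.exp (Real.log x) = x := Real.exp_log hx0
        have e2 : (1 + R + 1) ^ 2 ≤ Real.exp (2 * (R + 1)) := by
          have h : 1 + R + 1 ≤ Real.exp (R + 1) := by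
            have := Real.add_one_le_exp (R + 1); linarith
          have h0 : 0 ≤ 1 + R + 1 := by linarith
          rw [show (2 : ℝ) * (R + 1) = (R + 1) + (R + 1) by ring, Real.exp_add, pow_two]
          exact mul_le_mul h h h0 (h0.trans h)
        calc K * (1 + R + 1) ^ 2 * x * Real.exp ((1 + R - 1) * L + K * (1 + R))
            ≤ Real.exp (Real.log K) * Real.exp (2 * (R + 1)) * Real.exp (Real.log x) *
                Real.exp ((1 + R - 1) * L + K * (1 + R)) := by
              rw [e1, e3]; gcongr
          _ = Real.exp Q := by
              rw [hQ]; simp only [← Real.exp_add]; congr 1; ring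
      set M' : ℝ := Q + L * R with hM'
      have hbound : ∀ w : ℂ, ‖w‖ = R →
          ‖(cappedPoly x).eval (1 + w)‖ ≤ Real.exp (M' + L * w.re) := by
        intro w hw
        have hw1 : ‖(1 : ℂ) + w‖ ≤ 1 + R := by
          calc ‖(1 : ℂ) + w‖ ≤ ‖(1 : ℂ)‖ + ‖w‖ := norm_add_le _ _
            _ = 1 + R := by rw [norm_one, hw]
        have hwre : -R ≤ w.re := by
          have h := Complex.abs_re_le_norm w
          rw [hw] at h
          exact (abs_le.1 h).1
        rw [eval_cappedPoly]
        calc ‖∑ n ∈ Finset.range (x + 1), (1 + w) ^ capped n‖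
            ≤ ∑ n ∈ Finset.range (x + 1), (1 + R) ^ capped n := norm_sum_pow_le hw1
          _ ≤ K * (1 + R + 1) ^ 2 * x * Real.exp ((1 + R - 1) * L + K * (1 + R)) := hRk'
          _ ≤ Real.exp Q := hX₀
          _ ≤ Real.exp (M' + L * w.re) := by
              rw [hM']
              refine Real.exp_le_exp.2 ?_
              have : 0 ≤ L * (R + w.re) := mul_nonneg hL0.le (by linarith)
              linarith
      have hJen := stub_jensenPolynomial (cappedPoly x) L M' R hR0 (eval_cappedPoly_one_ne_zero x) hbound
      rw [hJ R]
      refine hJen.trans ?_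
      rw [norm_eval_cappedPoly_one, hM', hQ]
      have h1 : Real.log K ≤ |Real.log K| * R :=
        (le_abs_self _).trans (le_mul_of_one_le_right (abs_nonneg _) hR1)
      have h2 : Real.log (R + 2) ≤ R + 1 := by
        have := Real.log_le_sub_one_of_pos (show (0:ℝ) < R + 2 by linarith); linarith
      have h3 : K * (1 + R) ≤ 2 * K * R := by
        have := mul_le_mul_of_nonneg_left hR1 hK.le; linarith
      rw [hK₂]
      linarith [hlogx1, h1, h2, h3, hR1]
    /- conversion of the Jensen sums into the bound on `T(x)` -/
    have hB0 : 0 ≤ 2 * L + K₂ := by positivity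
    have hT := hconv A (2 * L + K₂) R₁ rts hA0 hB0 hR₁1 hpos H1 H2
    rw [repulsion_eq, ← hrts]
    refine hT.trans ?_
    have hq : (2 * L + K₂) / R₁ ≤ 2 * C' + K₂ * C' := by
      have hq1 : (2 * L + K₂) / R₁ = 2 * C' + K₂ * C' / L := by
        rw [hR₁]; field_simp
      rw [hq1]
      have : K₂ * C' / L ≤ K₂ * C' := div_le_self (by positivity) hL1
      linarith
    have hq0 : 0 ≤ (2 * L + K₂) / R₁ := by positivity
    have hκ : κ * (2 * L + K₂) / R₁ ≤ |κ| * (2 * C' + K₂ * C') := by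
      rw [mul_div_assoc]
      exact (mul_le_mul_of_nonneg_right (le_abs_self κ) hq0).trans
        (mul_le_mul_of_nonneg_left hq (abs_nonneg κ))
    calc Φ A + κ * (2 * L + K₂) / R₁ ≤ Φ A + |κ| * (2 * C' + K₂ * C') := by linarith
      _ ≤ Mbig := le_max_left _ _
  /- ### small `x`: finitely many, each `T(x)` is a finite sum -/
  set X₁ : ℕ := ⌈Real.exp (Real.exp C')⌉₊ with hX₁
  have hX₁ge : Real.exp (Real.exp C') ≤ (X₁ : ℝ) := Nat.le_ceil _
  have hsmall : ∀ x : ℕ, 2 ≤ x → ¬ (3 ≤ x ∧ C' ≤ Real.log (Real.log x)) → x ≤ X₁ := by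
    intro x hx2 hneg
    have hexp2 : (2 : ℝ) ≤ Real.exp (Real.exp C') := by
      have h1 := Real.add_one_le_exp C'
      have h2 := Real.add_one_le_exp (Real.exp C')
      linarith
    by_cases hx3 : 3 ≤ x
    · have hlt : Real.log (Real.log x) < C' := by
        by_contra h
        exact hneg ⟨hx3, not_lt.1 h⟩
      have hx0 : (0 : ℝ) < x := by exact_mod_cast (by omega : 0 < x)
      have hx1 : (1 : ℝ) < x := by exact_mod_cast (by omega : 1 < x)
      have hlog0 : 0 < Real.log x := Real.log_pos hx1
      have h1 : Real.log x < Real.exp C' := (Real.log_lt_iff_lt_exp hlog0).1 hlt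
      have h2 : (x : ℝ) < Real.exp (Real.exp C') := (Real.log_lt_iff_lt_exp hx0).1 h1
      exact_mod_cast (h2.le.trans hX₁ge)
    · have : (x : ℝ) ≤ X₁ := by
        have hx2' : (x : ℝ) ≤ 2 := by exact_mod_cast (by omega : x ≤ 2)
        linarith
      exact_mod_cast this
  /- ### assembly -/
  refine ⟨Mbig + ∑ x' ∈ Finset.range (X₁ + 1), repulsion x', fun x hx => ?_⟩
  change repulsion x ≤ Mbig + ∑ x' ∈ Finset.range (X₁ + 1), repulsion x'
  have hsum0 : 0 ≤ ∑ x' ∈ Finset.range (X₁ + 1), repulsion x' :=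
    Finset.sum_nonneg fun i _ => repulsion_nonneg i
  by_cases hreg : 3 ≤ x ∧ C' ≤ Real.log (Real.log x)
  · have := hlarge x hreg.1 hreg.2
    linarith
  · have hxX : x ≤ X₁ := hsmall x hx hreg
    have hle : repulsion x ≤ ∑ x' ∈ Finset.range (X₁ + 1), repulsion x' :=
      Finset.single_le_sum (fun i _ => repulsion_nonneg i)
        (Finset.mem_range.2 (Nat.lt_succ_of_le hxX))
    linarith

end Summit.Parity.BatemanHorn.Cruxes.LinearCappedRepulsion.LoglogDiscExplicitLsd

end
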